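import Mathlib
import Summits.CriticalPhenomena.PercolationContinuityZ3.Theses.PercBurnResprinkle
import Literature.Probability.Percolation.SupercriticalIsoperimetricProfile

/-!
# Sketch — crux VacantReignition (stmt-CriticalPhenomena-7203), crux-ideate round 1, ideator 2 (gen 2)

First-lemma signatures for the idea card `debris-ledger`
(bill the debris to the burnt set: mass-transport identity + anchored isoperimetry of the FRESH
sponge ⇒ the crux becomes a one-point moment inequality at a typical burnt vertex).

Everything is stated over existing declarations (`labelMeasure`, `configOfLabels`, `openCluster`,
`openGraph`, `openConnIn`, `criticalProb`, `zdGraph`, `box`, `openEdgeBoundaryCard`,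
`Pete2008_cor13`); nothing is proved here (`lean check` rc 0 is the only claim).
-/

namespace Summit.CriticalPhenomena.PercolationContinuityZ3.Cruxes.VacantReignition.LedgerSketch

open MeasureTheory Literature.Probability.Percolation Literature.Probability.LatticeModels
open scoped ENNReal Classical

noncomputable section

/-- Sites of `ℤ³`. -/
abbrev Site3 : Type := Fin 3 → ℤ
/-- The cubic lattice. -/
abbrev G3 : SimpleGraph Site3 := zdGraph 3
/-- Edge labels. -/
abbrev Lbl : Type := Sym2 Site3 → ℝ
/-- The route's product label measure: `π.1 = U` (environment), `π.2 = U′` (fresh field). -/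
abbrev μ2 : Measure (Lbl × Lbl) := (labelMeasure Site3).prod (labelMeasure Site3)
/-- `p_c(ℤ³)`. -/
abbrev pc : ℝ := criticalProb G3 0

/-- Burnt set `I_p(U)`: vertices whose level-`p` cluster is infinite (the crux's set-builder). -/
def burnt (p : ℝ) (U : Lbl) : Set Site3 := {y | (openCluster (configOfLabels p U G3) y).Infinite}

/-- The fresh sponge `J_q(U′)`: vertices whose FRESH level-`q` cluster is infinite. -/
def sponge (q : ℝ) (W : Lbl) : Set Site3 := {y | (openCluster (configOfLabels q W G3) y).Infinite}

/-- Vacant-fresh configuration at `(p, q)`: fresh `q`-open edges with both endpoints off `I_p`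
(LITERALLY the crux's configuration). -/
def vfCfg (p q : ℝ) (π : Lbl × Lbl) : BondConfig Site3 :=
  {e | e ∈ configOfLabels q π.2 G3 ∧ ∀ y ∈ e, y ∉ burnt p π.1}

/-- The vacant-fresh POCKET of `x`: its component in the vacant-fresh configuration. -/
def pocket (p q : ℝ) (π : Lbl × Lbl) (x : Site3) : Set Site3 := openCluster (vfCfg p q π) x

/-- DEBRIS: vertices of the fresh sponge, off the burnt set, whose vacant-fresh pocket is finite —
the part of the sponge that the burning disconnects from infinity. -/
def debris (p q : ℝ) (π : Lbl × Lbl) : Set Site3 :=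
  {x | x ∉ burnt p π.1 ∧ x ∈ sponge q π.2 ∧ (pocket p q π x).Finite}

/-- CONTACTS of a vertex set `F`: burnt vertices joined to `F` by a fresh `q`-open edge. -/
def contacts (p q : ℝ) (π : Lbl × Lbl) (F : Set Site3) : Set Site3 :=
  {a | a ∈ burnt p π.1 ∧ ∃ y ∈ F, s(a, y) ∈ configOfLabels q π.2 G3}

/-- The BILL at `a`: every debris vertex `x` sends unit mass, split equally among the contacts of
its pocket; `bill a` is the mass received at `a` (zero unless `a` is burnt). -/
def bill (p q : ℝ) (π : Lbl × Lbl) (a : Site3) : ℝ≥0∞ :=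
  ∑' x : Site3, if x ∈ debris p q π ∧ a ∈ contacts p q π (pocket p q π x)
    then ((contacts p q π (pocket p q π x)).ncard : ℝ≥0∞)⁻¹ else 0

/-- **DEBRIS LEDGER** (mass-transport identity on `ℤ³`, joint law of `(U, U′)` translation
invariant): debris density = expected bill at the origin.  Each debris pocket is finite, contained in
the sponge, and has at least one contact (a fresh-open path from the pocket to infinity leaves it
through a fresh-open edge whose far endpoint is not in the pocket, hence burnt), so the transport is
well defined; MTP on the amenable, unimodular `ℤ³` is Fubini + translation invariance. -/
def DebrisLedger : Prop :=
  ∀ p q : ℝ, μ2 {π | (0 : Site3) ∈ debris p q π} = ∫⁻ π, bill p q π 0 ∂μ2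

/-- `θ(p)` read from labels (`= theta (zdGraph 3) 0 p` via `map_configOfLabels`, for `p ∈ [0,1]`). -/
def thetaL (p : ℝ) : ℝ := (labelMeasure Site3).real {U | (0 : Site3) ∈ burnt p U}

/-- The crux's quantity: probability that the origin's vacant-fresh pocket is infinite. -/
def thetaVF (p q : ℝ) : ℝ := μ2.real {π | (pocket p q π 0).Infinite}

/-- **PARTITION BOUND** (elementary): a vertex is burnt, or has an infinite pocket, or is debris, or
lies in a finite FRESH cluster; hence `θ_vf(p,q) ≥ θ(q) − θ(p) − (debris density)`. -/
def PartitionBound : Prop :=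
  ∀ p q : ℝ, thetaL q - thetaL p - μ2.real {π | (0 : Site3) ∈ debris p q π} ≤ thetaVF p q

/-- Total volume of the (finite, sponge) pockets fresh-adjacent to the origin. -/
def pocketVolume (p q : ℝ) (π : Lbl × Lbl) : ℕ :=
  Set.ncard (⋃ x ∈ {x : Site3 | s((0 : Site3), x) ∈ configOfLabels q π.2 G3 ∧ x ∈ debris p q π},
    pocket p q π x)

/-- **VOLUME CRITERION** at `ε`: for some `p > p_c`, the mean debris volume hanging at a burnt origin,
times `θ(p)` (the integral is over `{0 burnt}`), is smaller than the sponge increment `θ(p_c+ε) − θ(p)`. -/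
def VolumeCriterion (ε : ℝ) : Prop :=
  ∃ p : ℝ, pc < p ∧
    ∫ π in {π | (0 : Site3) ∈ burnt p π.1}, (pocketVolume p (pc + ε) π : ℝ) ∂μ2
      < thetaL (pc + ε) - thetaL p

/-- **LEDGER REDUCTION — the FIRST LEMMA of the line** (provable now, size M: `PartitionBound` +
`DebrisLedger` + `|contacts| ≥ 1`, so that `bill 0 ≤ pocketVolume`): the volume criterion for every
`ε` gives the crux VERBATIM. -/
def LedgerReduction : Prop :=
  (∀ ε : ℝ, 0 < ε → VolumeCriterion ε) → Theses.PercBurnResprinkle.VacantReignition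

/-- Per-`ε` form with the crux's set literal spelled out (it is `vfCfg` by `rfl`). -/
def LedgerReductionAt (ε : ℝ) : Prop :=
  VolumeCriterion ε → ∃ p : ℝ, pc < p ∧ 0 < μ2.real {π : Lbl × Lbl |
    (openCluster {e | e ∈ configOfLabels (pc + ε) π.2 G3 ∧
      ∀ y ∈ e, ¬ (openCluster (configOfLabels p π.1 G3) y).Infinite} (0 : Site3)).Infinite}

/-! ## The isoperimetric upgrade: volume → radius -/

/-- The six lattice neighbours of the origin. -/
def nbr (i : Fin 3) (s : Bool) : Site3 := Pi.single i (if s then 1 else -1)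

/-- Sum over the fresh-adjacent debris pockets at the origin of `|F|^{1/3}` (a pocket met through
several neighbours is counted at most six times — harmless). -/
def pocketRadiusSum (p q : ℝ) (π : Lbl × Lbl) : ℝ :=
  ∑ i : Fin 3, ∑ s : Bool,
    if s((0 : Site3), nbr i s) ∈ configOfLabels q π.2 G3 ∧ nbr i s ∈ debris p q π
    then ((pocket p q π (nbr i s)).ncard : ℝ) ^ ((1 : ℝ) / 3) else 0

/-- **RADIUS CRITERION** at `ε` with constant `C`: `θ(p) · C · E[1 + Σ_F |F|^{1/3} | 0 burnt]`
below the sponge increment, for some `p > p_c`. -/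
def RadiusCriterion (C ε : ℝ) : Prop :=
  ∃ p : ℝ, pc < p ∧
    C * ∫ π in {π | (0 : Site3) ∈ burnt p π.1}, (1 + pocketRadiusSum p (pc + ε) π) ∂μ2
      < thetaL (pc + ε) - thetaL p

/-- Pete 2008, Thm 1.2 shape at level `q` for the FRESH sponge, anchored at a vertex `x`
(quantitative anchored isoperimetry; `Pete2008_cor13` in the tree is its Borel–Cantelli corollary):
finite fresh-open-connected `S ∋ x` inside the sponge with `|S| ≥ M` and fewer than `α |S|^{2/3}`
open boundary edges have probability `≤ exp(−c₂ M^{2/3})`. -/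
def PeteAnchored (q α c₂ : ℝ) : Prop :=
  ∀ x : Site3, ∀ M : ℕ, 1 ≤ M →
    (labelMeasure Site3) {W | ∃ S : Finset Site3, x ∈ S ∧ (↑S : Set Site3) ⊆ sponge q W ∧
        (∀ a ∈ S, ∀ b ∈ S, configOfLabels q W G3 ∈ openConnIn (↑S : Set Site3) a b) ∧
        M ≤ S.card ∧
        (openEdgeBoundaryCard 3 (configOfLabels q W G3) S : ℝ) < α * (S.card : ℝ) ^ ((2 : ℝ) / 3)}
      ≤ ENNReal.ofReal (Real.exp (-c₂ * (M : ℝ) ^ ((2 : ℝ) / 3)))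

/-- **RADIUS REDUCTION** (size M–L, provable from `PeteAnchored`): a pocket `F` is a finite
fresh-open-connected subset of the sponge whose open boundary edges all end at contacts, so
`|contacts F| ≥ |∂_J F| / 6 ≥ (α/6) |F|^{2/3}` off an event of probability `exp(−c₂|F|^{2/3})`; hence
`bill 0 ≤ C(α, c₂) (1 + Σ_F |F|^{1/3})` in mean, and the radius criterion gives the crux at `ε`. -/
def RadiusReduction : Prop :=
  ∀ α c₂ : ℝ, 0 < α → 0 < c₂ → ∃ C : ℝ, 0 < C ∧ ∀ ε : ℝ, 0 < ε →
    PeteAnchored (pc + ε) α c₂ → RadiusCriterion C ε →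
      ∃ p : ℝ, pc < p ∧ 0 < thetaVF p (pc + ε)

/-! ## Free range: below scale `θ(p)⁻¹` the burnt mass cannot cut the fresh sponge -/

/-- **FREE RANGE** (min-cut of the fresh sponge vs burnt mass; Kesten 1987 / Zhang / Rossignol–Théret
flow constant `ν(q) > 0` for `q > p_c`, Menger = `MinOpenCutMenger`, Markov on `|I_p ∩ Λ_n|`):
for `q > p_c` there is `c > 0` such that for every `η > 0`, all large `n` and EVERY `p`, the box
`Λ_n` is crossed top-to-bottom by a fresh `q`-open path avoiding `I_p` with probability
`≥ 1 − η − θ(p) n / c`. In a `θ(p_c) = 0` world this exhibits vacant-fresh crossings at every scale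
`n ≪ θ(p)⁻¹ = ξ(p)^{β/ν}` — the difficulty of the crux lives only above that scale. -/
def FreeRange : Prop :=
  ∀ q : ℝ, pc < q → ∃ c : ℝ, 0 < c ∧ ∀ η : ℝ, 0 < η → ∃ n₀ : ℕ, ∀ n : ℕ, n₀ ≤ n → ∀ p : ℝ,
    1 - η - thetaL p * n / c ≤
      μ2.real {π | ∃ x y : Site3, x ∈ (box 3 n : Set Site3) ∧ y ∈ (box 3 n : Set Site3) ∧
        x 0 = -(n : ℤ) ∧ y 0 = (n : ℤ) ∧ vfCfg p q π ∈ openConnIn (box 3 n : Set Site3) x y}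

/-- The whole ledger line in one implication (bookkeeping only; the open content is the radius
criterion for every `ε`). -/
def LedgerLine : Prop :=
  PartitionBound → DebrisLedger → RadiusReduction →
    (∃ α c₂ : ℝ, 0 < α ∧ 0 < c₂ ∧ ∀ ε : ℝ, 0 < ε → PeteAnchored (pc + ε) α c₂) →
    (∀ C : ℝ, 0 < C → ∀ ε : ℝ, 0 < ε → RadiusCriterion C ε) →
    Theses.PercBurnResprinkle.VacantReignition

/-- Sanity: the crux's event is the infinite-pocket event (definitional). -/
example (p ε : ℝ) (π : Lbl × Lbl) :
    (pocket p (pc + ε) π 0).Infinite ↔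
    (openCluster {e | e ∈ configOfLabels (pc + ε) π.2 G3 ∧
      ∀ y ∈ e, ¬ (openCluster (configOfLabels p π.1 G3) y).Infinite} (0 : Site3)).Infinite :=
  Iff.rfl

end

end Summit.CriticalPhenomena.PercolationContinuityZ3.Cruxes.VacantReignition.LedgerSketch
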